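import Mathlib
import HarnessLib
import Summits.HubbardSuperconductivity.HubbardSuperconductivity.Theorems.KLProgrammeKLRegimeVolumeLimitDefs

/-!
# Route `KLProgramme` — crux K3 `KLRegimeTwoPointLimit` (stmt-HubbardSuperconductivity-19937), child «VolumeLimitP»
# (`VolumeLimitP klPredsV7 FinalTwoLegVolLimit klWindowC`): the TANNERY BRIDGE from termwise volume limits to the slot text
# `FinalTwoLegVolLimit β U μ K Mstar` (cell gate-hubbard-kl, seat hubbard-kl-k3c4-p1, technique «volume lemmas»)

WHY.  The volume-limit text of record (`KLProgrammeKLRegimeVolumeLimitDefs.FinalTwoLegVolLimit`, hubbard-kl-r2d-p2) asks, for the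
two-leg vertex function `Σ̂_{L,M} = klSelfEnergy L M β U μ K klE0 (nScales β + 1)` of the fully integrated countertermed action,
(i) a bound `B` uniform in the volume `(L, M)` beyond `(L₀, Mstar)`, and (ii) for every Matsubara integer `n`, convergence on the
torus momentum grid, uniformly on the grid, eventually in `L` and then in `M`, to a momentum-CONTINUOUS limit `Σ∞ n p σ`.  No
per-volume slot of the bundle supplies either clause (`…SplitGenericV3`, Δ-asm (A): «termwise limits of running blocks … engine-
internal»); what the engine's single-scale expansion DOES produce is TERMWISE data: beyond thresholds, `Σ̂_{L,M}(k, σ) = Σ_t v_t(L, M; k, σ)`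
(a countable family of tree values summed over the scales `j ≤ n_β + 1`), with `L`-UNIFORM SUMMABLE MAJORANTS `‖v_t(L,M;k,σ)‖ ≤ m_t`,
`Σ_t m_t < ∞` (Gram–Hadamard × sector counting, BGM 2006 (2.77); [BM2001] §2.3 fn. 1: «bounds uniform in L»), and TERMWISE grid limits
`v_t(L, M; (ω, k⃗), σ) → v∞_t(n, p_{k⃗}, σ)` (Riemann sums of `L`-independent single-scale propagators, `BrillouinRiemannSum`;
periodisation in `x`-space, `HubbardFreePropagatorPeriodization`) to continuous limits bounded by the same majorants.  This module is
the one step between the two: TANNERY's theorem (dominated convergence for series) in the exact quantifier shape of the VL text —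
the KL-regime transplant of `HubbardTwoPointLimitReduction.tendsto_hubbardThermalTwoPoint_of_truncated_bounds` (there: a `U`-power
series; here: any summable family, since at `β ~ e^{c/U²}` the expansion is not a power series in `U`).

* `volLimit_of_termwise` — ABSTRACT form, for any volume-indexed grid family `S L M : FreqMomentum L M → Fin 2 → ℂ`: termwise
  representation (`HasSum`) beyond `(L₀, Mstar)` + uniform summable majorants + continuous bounded termwise limits + termwise grid
  convergence ⇒ the three clauses of the VL text for `S` with `Σ∞ = Σ'_t v∞_t`, `B = Σ'_t m_t`;
* `finalTwoLegVolLimit_of_termwise` — the instance `S = klSelfEnergy … (nScales β + 1)`: **termwise data ⇒ `FinalTwoLegVolLimit β U μ K Mstar`**.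

Pure bookkeeping (Mathlib's `continuous_tsum`, `HasSum.norm_le_of_bounded`, `tendsto_tsum_compl_atTop_zero`,
`Summable.sum_add_tsum_compl`); nothing is asserted about the model.  References: G. Benfatto, A. Giuliani, V. Mastropietro,
Ann. Henri Poincaré 7 (2006) 809–898, §2.3 footnote 1, §2.4; G. Benfatto, V. Mastropietro, Rev. Math. Phys. 13 (2001) 1323, §2.3.
-/

noncomputable section

namespace Summit.HubbardSuperconductivity.HubbardSuperconductivity.Theorems.KLRegimeSplit

set_option linter.dupNamespace false -- summit = problem name (single-conjunct summit), D-0017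

open Filter Topology Finset Literature.MathematicalPhysics.QuantumLattice Literature.Probability.LatticeModels
open Summit.HubbardSuperconductivity.HubbardSuperconductivity.Theorems.KLProgrammeLegKernels

/-- **Tannery's theorem in the quantifier shape of the volume-limit slot** (abstract form).  Let `S L M : FreqMomentum L M → Fin 2 → ℂ`
be a volume-indexed grid family with, beyond the thresholds `(L₀, Mstar)`, a termwise representation `S = Σ_t v_t` (`HasSum`) whose terms
obey `L`-uniform summable majorants `‖v_t‖ ≤ m_t`, and suppose every term converges on the grid — per Matsubara integer `n`, uniformly on
the momentum grid, eventually in `L` and then in `M` — to a continuous limit `v∞_t n · σ` bounded by the same `m_t`.  Then `S` is bounded by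
`B = Σ'_t m_t` beyond `(L₀, Mstar)` and converges on the grid, in the same sense, to the continuous function `Σ∞ n p σ = Σ'_t v∞_t n p σ`. -/
theorem volLimit_of_termwise
    {S : ∀ (L M : ℕ) [NeZero L] [NeZero M], FreqMomentum L M → Fin 2 → ℂ} {Mstar : ℕ → ℕ} {ι : Type*}
    {v : ι → ∀ (L M : ℕ) [NeZero L] [NeZero M], FreqMomentum L M → Fin 2 → ℂ} {vInf : ι → ℤ → (Fin 2 → ℝ) → Fin 2 → ℂ}
    {m : ι → ℝ} (hm : Summable m) {L₀ : ℕ}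
    (hrepr : ∀ (L : ℕ) [NeZero L], L₀ ≤ L → ∀ (M : ℕ) [NeZero M], Mstar L ≤ M →
      ∀ (k : FreqMomentum L M) (σ : Fin 2), HasSum (fun t => v t L M k σ) (S L M k σ))
    (hmaj : ∀ (t : ι) (L : ℕ) [NeZero L], L₀ ≤ L → ∀ (M : ℕ) [NeZero M], Mstar L ≤ M →
      ∀ (k : FreqMomentum L M) (σ : Fin 2), ‖v t L M k σ‖ ≤ m t)
    (hcont : ∀ (t : ι) (n : ℤ) (σ : Fin 2), Continuous fun p : Fin 2 → ℝ => vInf t n p σ)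
    (hbdd : ∀ (t : ι) (n : ℤ) (p : Fin 2 → ℝ) (σ : Fin 2), ‖vInf t n p σ‖ ≤ m t)
    (hlim : ∀ (t : ι) (n : ℤ) (σ : Fin 2) (ε : ℝ), 0 < ε → ∃ L₁ : ℕ, ∀ (L : ℕ) [NeZero L], L₁ ≤ L →
      ∃ M₁ : ℕ, ∀ (M : ℕ) [NeZero M], M₁ ≤ M → ∀ ω : MatsubaraIdx M, matsubaraInt M ω = n →
        ∀ k : TorusSite 2 L, ‖v t L M (ω, k) σ - vInf t n (latticeMomentum L k) σ‖ ≤ ε) :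
    ∃ sigmaInf : ℤ → (Fin 2 → ℝ) → Fin 2 → ℂ, ∃ B : ℝ, ∃ L₀' : ℕ,
      (∀ (n : ℤ) (σ : Fin 2), Continuous fun p : Fin 2 → ℝ => sigmaInf n p σ) ∧
      (∀ (L : ℕ) [NeZero L], L₀' ≤ L → ∀ (M : ℕ) [NeZero M], Mstar L ≤ M →
        ∀ (k : FreqMomentum L M) (σ : Fin 2), ‖S L M k σ‖ ≤ B) ∧
      (∀ (n : ℤ) (σ : Fin 2) (ε : ℝ), 0 < ε → ∃ L₁ : ℕ, ∀ (L : ℕ) [NeZero L], L₁ ≤ L →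
        ∃ M₁ : ℕ, ∀ (M : ℕ) [NeZero M], M₁ ≤ M → ∀ ω : MatsubaraIdx M, matsubaraInt M ω = n →
          ∀ k : TorusSite 2 L, ‖S L M (ω, k) σ - sigmaInf n (latticeMomentum L k) σ‖ ≤ ε) := by
  classical
  have hvInf : ∀ (n : ℤ) (p : Fin 2 → ℝ) (σ : Fin 2), Summable fun t => vInf t n p σ := fun n p σ =>
    Summable.of_norm_bounded hm fun t => hbdd t n p σ
  refine ⟨fun n p σ => ∑' t, vInf t n p σ, ∑' t, m t, L₀, ?_, ?_, ?_⟩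
  · intro n σ
    exact continuous_tsum (fun t => hcont t n σ) hm fun t p => hbdd t n p σ
  · intro L _ hL M _ hM k σ
    exact (hrepr L hL M hM k σ).norm_le_of_bounded hm.hasSum fun t => hmaj t L hL M hM k σ
  · intro n σ ε hε
    -- the tail of the majorant series beyond a finite set `T` is `< ε/3`
    obtain ⟨T, hT⟩ : ∃ T : Finset ι, ∑' t : {x // x ∉ T}, m t < ε / 3 :=
      ((tendsto_tsum_compl_atTop_zero m).eventually (gt_mem_nhds (by positivity))).exists
    -- head thresholds, one per term of `T`
    have hε' : 0 < ε / (3 * ((T.card : ℝ) + 1)) := by positivity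
    choose L₁ hL₁ using fun t => hlim t n σ _ hε'
    refine ⟨max L₀ (T.sup L₁), fun L _ hL => ?_⟩
    have hL0 : L₀ ≤ L := le_of_max_le_left hL
    have hLT : ∀ t ∈ T, L₁ t ≤ L := fun t ht => (Finset.le_sup ht).trans (le_of_max_le_right hL)
    choose M₁ hM₁ using fun t : T => hL₁ t L (hLT t t.2)
    refine ⟨max (Mstar L) (Finset.univ.sup M₁), fun M _ hM ω hω k => ?_⟩
    have hMs : Mstar L ≤ M := le_of_max_le_left hM
    have hMT : ∀ t : T, M₁ t ≤ M := fun t => (Finset.le_sup (Finset.mem_univ t)).trans (le_of_max_le_right hM)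
    -- the difference series
    set d : ι → ℂ := fun t => v t L M (ω, k) σ - vInf t n (latticeMomentum L k) σ with hd
    have hD : HasSum d (S L M (ω, k) σ - ∑' t, vInf t n (latticeMomentum L k) σ) :=
      (hrepr L hL0 M hMs (ω, k) σ).sub (hvInf n _ σ).hasSum
    have hds : Summable d := hD.summable
    rw [← hD.tsum_eq, ← hds.sum_add_tsum_compl (s := T)]
    -- head
    have hhead : ‖∑ t ∈ T, d t‖ ≤ T.card * (ε / (3 * ((T.card : ℝ) + 1))) := by
      have h := norm_sum_le_of_le T (f := d) (fun t ht => hM₁ ⟨t, ht⟩ M (hMT ⟨t, ht⟩) ω hω k)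
      simpa [Finset.sum_const, nsmul_eq_mul] using h
    -- tail
    have hm2 : HasSum (fun t : ((T : Set ι)ᶜ : Set ι) => 2 * m t) (2 * ∑' t : ((T : Set ι)ᶜ : Set ι), m t) :=
      ((hm.subtype _).hasSum).mul_left 2
    have htail : ‖∑' t : ((T : Set ι)ᶜ : Set ι), d t‖ ≤ 2 * ∑' t : ((T : Set ι)ᶜ : Set ι), m t := by
      refine tsum_of_norm_bounded hm2 fun t => ?_
      calc ‖d t‖ ≤ ‖v t L M (ω, k) σ‖ + ‖vInf t n (latticeMomentum L k) σ‖ := norm_sub_le _ _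
        _ ≤ m t + m t := add_le_add (hmaj t L hL0 M hMs (ω, k) σ) (hbdd t n _ σ)
        _ = 2 * m t := by ring
    have htail' : ∑' t : ((T : Set ι)ᶜ : Set ι), m t < ε / 3 := hT
    have hcard : (T.card : ℝ) * (ε / (3 * ((T.card : ℝ) + 1))) ≤ ε / 3 := by
      rw [mul_div_assoc']
      rw [div_le_div_iff₀ (by positivity) (by positivity)]
      nlinarith [hε, (Nat.cast_nonneg T.card : (0 : ℝ) ≤ T.card)]
    calc ‖∑ t ∈ T, d t + ∑' t : ((T : Set ι)ᶜ : Set ι), d t‖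
        ≤ ‖∑ t ∈ T, d t‖ + ‖∑' t : ((T : Set ι)ᶜ : Set ι), d t‖ := norm_add_le _ _
      _ ≤ ε / 3 + 2 * (ε / 3) := add_le_add (hhead.trans hcard) (htail.trans (by linarith))
      _ = ε := by ring

/-- **Termwise data ⇒ the volume-limit slot.**  If, beyond thresholds `(L₀, Mstar)`, the two-leg vertex function of the fully integrated
countertermed action, `klSelfEnergy L M β U μ K klE0 (nScales β + 1)`, has a termwise representation `Σ_t v_t` with `L`-uniform
summable majorants `m_t`, and every term converges on the grid (per Matsubara integer, uniformly on the momentum grid, eventually in `L`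
and then in `M`) to a continuous limit `v∞_t` bounded by `m_t`, then `FinalTwoLegVolLimit β U μ K Mstar` holds, with
`Σ∞ = Σ'_t v∞_t` and `B = Σ'_t m_t` (BGM 2006 §2.3 fn. 1 / §2.4: bounds uniform in `L`, then the limit term by term). -/
theorem finalTwoLegVolLimit_of_termwise {β U μ : ℝ} {K : TrigPolyC4v} {Mstar : ℕ → ℕ} {ι : Type*}
    {v : ι → ∀ (L M : ℕ) [NeZero L] [NeZero M], FreqMomentum L M → Fin 2 → ℂ} {vInf : ι → ℤ → (Fin 2 → ℝ) → Fin 2 → ℂ}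
    {m : ι → ℝ} (hm : Summable m) {L₀ : ℕ}
    (hrepr : ∀ (L : ℕ) [NeZero L], L₀ ≤ L → ∀ (M : ℕ) [NeZero M], Mstar L ≤ M →
      ∀ (k : FreqMomentum L M) (σ : Fin 2),
        HasSum (fun t => v t L M k σ) (klSelfEnergy L M β U μ K klE0 (nScales β + 1) k σ))
    (hmaj : ∀ (t : ι) (L : ℕ) [NeZero L], L₀ ≤ L → ∀ (M : ℕ) [NeZero M], Mstar L ≤ M →
      ∀ (k : FreqMomentum L M) (σ : Fin 2), ‖v t L M k σ‖ ≤ m t)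
    (hcont : ∀ (t : ι) (n : ℤ) (σ : Fin 2), Continuous fun p : Fin 2 → ℝ => vInf t n p σ)
    (hbdd : ∀ (t : ι) (n : ℤ) (p : Fin 2 → ℝ) (σ : Fin 2), ‖vInf t n p σ‖ ≤ m t)
    (hlim : ∀ (t : ι) (n : ℤ) (σ : Fin 2) (ε : ℝ), 0 < ε → ∃ L₁ : ℕ, ∀ (L : ℕ) [NeZero L], L₁ ≤ L →
      ∃ M₁ : ℕ, ∀ (M : ℕ) [NeZero M], M₁ ≤ M → ∀ ω : MatsubaraIdx M, matsubaraInt M ω = n →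
        ∀ k : TorusSite 2 L, ‖v t L M (ω, k) σ - vInf t n (latticeMomentum L k) σ‖ ≤ ε) :
    FinalTwoLegVolLimit β U μ K Mstar :=
  volLimit_of_termwise (S := fun L M _ _ k σ => klSelfEnergy L M β U μ K klE0 (nScales β + 1) k σ)
    hm hrepr hmaj hcont hbdd hlim

/-! ## Frequency-dependent majorants (two loops and beyond)

At two loops (the order-`U²` sunset) and beyond, a termwise family indexed by the internal Matsubara integers has NO
majorant that is summable UNIFORMLY in the external frequency (`Σ_{a,b} sup_n (|ω_a||ω_b||ω_{n+b-a}|)⁻¹ = ∞`), while for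
each FIXED external Matsubara integer `n` the majorants are summable with sums bounded uniformly in `n`.  The variant below
therefore lets the majorant depend on the external Matsubara integer: `‖v_t(L,M;(ω,k⃗),σ)‖ ≤ m_{n(ω)}(t)`, `Σ_t m_n(t) ≤ B`
for every `n` — clause (i) of the VL text reads the uniform `B`, clause (ii) (at fixed `n`) reads `m_n`. -/

/-- **Tannery in the VL quantifier shape, frequency-dependent majorants** (abstract form): as `volLimit_of_termwise`, but the
termwise majorant `m n t` may depend on the external Matsubara integer `n = matsubaraInt M ω`, with `Σ'_t m n t ≤ B` for every `n`
(the shape met by multi-loop terms, whose frequency sums converge at each external frequency with an `n`-uniform value but admit no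
`n`-uniform termwise majorant). -/
theorem volLimit_of_termwise_freq
    {S : ∀ (L M : ℕ) [NeZero L] [NeZero M], FreqMomentum L M → Fin 2 → ℂ} {Mstar : ℕ → ℕ} {ι : Type*}
    {v : ι → ∀ (L M : ℕ) [NeZero L] [NeZero M], FreqMomentum L M → Fin 2 → ℂ} {vInf : ι → ℤ → (Fin 2 → ℝ) → Fin 2 → ℂ}
    {m : ℤ → ι → ℝ} (hm : ∀ n : ℤ, Summable (m n)) {B : ℝ} (hB : ∀ n : ℤ, ∑' t, m n t ≤ B) {L₀ : ℕ}
    (hrepr : ∀ (L : ℕ) [NeZero L], L₀ ≤ L → ∀ (M : ℕ) [NeZero M], Mstar L ≤ M →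
      ∀ (k : FreqMomentum L M) (σ : Fin 2), HasSum (fun t => v t L M k σ) (S L M k σ))
    (hmaj : ∀ (t : ι) (L : ℕ) [NeZero L], L₀ ≤ L → ∀ (M : ℕ) [NeZero M], Mstar L ≤ M →
      ∀ (ω : MatsubaraIdx M) (k : TorusSite 2 L) (σ : Fin 2), ‖v t L M (ω, k) σ‖ ≤ m (matsubaraInt M ω) t)
    (hcont : ∀ (t : ι) (n : ℤ) (σ : Fin 2), Continuous fun p : Fin 2 → ℝ => vInf t n p σ)
    (hbdd : ∀ (t : ι) (n : ℤ) (p : Fin 2 → ℝ) (σ : Fin 2), ‖vInf t n p σ‖ ≤ m n t)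
    (hlim : ∀ (t : ι) (n : ℤ) (σ : Fin 2) (ε : ℝ), 0 < ε → ∃ L₁ : ℕ, ∀ (L : ℕ) [NeZero L], L₁ ≤ L →
      ∃ M₁ : ℕ, ∀ (M : ℕ) [NeZero M], M₁ ≤ M → ∀ ω : MatsubaraIdx M, matsubaraInt M ω = n →
        ∀ k : TorusSite 2 L, ‖v t L M (ω, k) σ - vInf t n (latticeMomentum L k) σ‖ ≤ ε) :
    ∃ sigmaInf : ℤ → (Fin 2 → ℝ) → Fin 2 → ℂ, ∃ B : ℝ, ∃ L₀' : ℕ,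
      (∀ (n : ℤ) (σ : Fin 2), Continuous fun p : Fin 2 → ℝ => sigmaInf n p σ) ∧
      (∀ (L : ℕ) [NeZero L], L₀' ≤ L → ∀ (M : ℕ) [NeZero M], Mstar L ≤ M →
        ∀ (k : FreqMomentum L M) (σ : Fin 2), ‖S L M k σ‖ ≤ B) ∧
      (∀ (n : ℤ) (σ : Fin 2) (ε : ℝ), 0 < ε → ∃ L₁ : ℕ, ∀ (L : ℕ) [NeZero L], L₁ ≤ L →
        ∃ M₁ : ℕ, ∀ (M : ℕ) [NeZero M], M₁ ≤ M → ∀ ω : MatsubaraIdx M, matsubaraInt M ω = n →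
          ∀ k : TorusSite 2 L, ‖S L M (ω, k) σ - sigmaInf n (latticeMomentum L k) σ‖ ≤ ε) := by
  classical
  have hvInf : ∀ (n : ℤ) (p : Fin 2 → ℝ) (σ : Fin 2), Summable fun t => vInf t n p σ := fun n p σ =>
    Summable.of_norm_bounded (hm n) fun t => hbdd t n p σ
  refine ⟨fun n p σ => ∑' t, vInf t n p σ, B, L₀, ?_, ?_, ?_⟩
  · intro n σ
    exact continuous_tsum (fun t => hcont t n σ) (hm n) fun t p => hbdd t n p σ
  · intro L _ hL M _ hM k σ
    obtain ⟨ω, kk⟩ := k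
    exact ((hrepr L hL M hM (ω, kk) σ).norm_le_of_bounded (hm _).hasSum
      fun t => hmaj t L hL M hM ω kk σ).trans (hB _)
  · intro n σ ε hε
    -- the tail of the scale-`n` majorant series beyond a finite set `T` is `< ε/3`
    obtain ⟨T, hT⟩ : ∃ T : Finset ι, ∑' t : {x // x ∉ T}, m n t < ε / 3 :=
      ((tendsto_tsum_compl_atTop_zero (m n)).eventually (gt_mem_nhds (by positivity))).exists
    have hε' : 0 < ε / (3 * ((T.card : ℝ) + 1)) := by positivity
    choose L₁ hL₁ using fun t => hlim t n σ _ hε'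
    refine ⟨max L₀ (T.sup L₁), fun L _ hL => ?_⟩
    have hL0 : L₀ ≤ L := le_of_max_le_left hL
    have hLT : ∀ t ∈ T, L₁ t ≤ L := fun t ht => (Finset.le_sup ht).trans (le_of_max_le_right hL)
    choose M₁ hM₁ using fun t : T => hL₁ t L (hLT t t.2)
    refine ⟨max (Mstar L) (Finset.univ.sup M₁), fun M _ hM ω hω k => ?_⟩
    have hMs : Mstar L ≤ M := le_of_max_le_left hM
    have hMT : ∀ t : T, M₁ t ≤ M := fun t => (Finset.le_sup (Finset.mem_univ t)).trans (le_of_max_le_right hM)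
    set d : ι → ℂ := fun t => v t L M (ω, k) σ - vInf t n (latticeMomentum L k) σ with hd
    have hD : HasSum d (S L M (ω, k) σ - ∑' t, vInf t n (latticeMomentum L k) σ) :=
      (hrepr L hL0 M hMs (ω, k) σ).sub (hvInf n _ σ).hasSum
    have hds : Summable d := hD.summable
    rw [← hD.tsum_eq, ← hds.sum_add_tsum_compl (s := T)]
    have hhead : ‖∑ t ∈ T, d t‖ ≤ T.card * (ε / (3 * ((T.card : ℝ) + 1))) := by
      have h := norm_sum_le_of_le T (f := d) (fun t ht => hM₁ ⟨t, ht⟩ M (hMT ⟨t, ht⟩) ω hω k)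
      simpa [Finset.sum_const, nsmul_eq_mul] using h
    have hm2 : HasSum (fun t : ((T : Set ι)ᶜ : Set ι) => 2 * m n t) (2 * ∑' t : ((T : Set ι)ᶜ : Set ι), m n t) :=
      (((hm n).subtype _).hasSum).mul_left 2
    have htail : ‖∑' t : ((T : Set ι)ᶜ : Set ι), d t‖ ≤ 2 * ∑' t : ((T : Set ι)ᶜ : Set ι), m n t := by
      refine tsum_of_norm_bounded hm2 fun t => ?_
      have hω : ‖v t L M (ω, k) σ‖ ≤ m n t := by
        have h := hmaj t L hL0 M hMs ω k σ
        rwa [hω] at h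
      calc ‖d t‖ ≤ ‖v t L M (ω, k) σ‖ + ‖vInf t n (latticeMomentum L k) σ‖ := norm_sub_le _ _
        _ ≤ m n t + m n t := add_le_add hω (hbdd t n _ σ)
        _ = 2 * m n t := by ring
    have htail' : ∑' t : ((T : Set ι)ᶜ : Set ι), m n t < ε / 3 := hT
    have hcard : (T.card : ℝ) * (ε / (3 * ((T.card : ℝ) + 1))) ≤ ε / 3 := by
      rw [mul_div_assoc']
      rw [div_le_div_iff₀ (by positivity) (by positivity)]
      nlinarith [hε, (Nat.cast_nonneg T.card : (0 : ℝ) ≤ T.card)]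
    calc ‖∑ t ∈ T, d t + ∑' t : ((T : Set ι)ᶜ : Set ι), d t‖
        ≤ ‖∑ t ∈ T, d t‖ + ‖∑' t : ((T : Set ι)ᶜ : Set ι), d t‖ := norm_add_le _ _
      _ ≤ ε / 3 + 2 * (ε / 3) := add_le_add (hhead.trans hcard) (htail.trans (by linarith))
      _ = ε := by ring

/-- **Termwise data with frequency-dependent majorants ⇒ the volume-limit slot**: the instance
`S = klSelfEnergy … (nScales β + 1)` of `volLimit_of_termwise_freq` (the form the order-`U²` sunset and every multi-loop term of
the engine's expansion meet: per external Matsubara integer `n` a summable majorant `m n`, sums bounded by one `B`). -/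
theorem finalTwoLegVolLimit_of_termwise_freq {β U μ : ℝ} {K : TrigPolyC4v} {Mstar : ℕ → ℕ} {ι : Type*}
    {v : ι → ∀ (L M : ℕ) [NeZero L] [NeZero M], FreqMomentum L M → Fin 2 → ℂ} {vInf : ι → ℤ → (Fin 2 → ℝ) → Fin 2 → ℂ}
    {m : ℤ → ι → ℝ} (hm : ∀ n : ℤ, Summable (m n)) {B : ℝ} (hB : ∀ n : ℤ, ∑' t, m n t ≤ B) {L₀ : ℕ}
    (hrepr : ∀ (L : ℕ) [NeZero L], L₀ ≤ L → ∀ (M : ℕ) [NeZero M], Mstar L ≤ M →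
      ∀ (k : FreqMomentum L M) (σ : Fin 2),
        HasSum (fun t => v t L M k σ) (klSelfEnergy L M β U μ K klE0 (nScales β + 1) k σ))
    (hmaj : ∀ (t : ι) (L : ℕ) [NeZero L], L₀ ≤ L → ∀ (M : ℕ) [NeZero M], Mstar L ≤ M →
      ∀ (ω : MatsubaraIdx M) (k : TorusSite 2 L) (σ : Fin 2), ‖v t L M (ω, k) σ‖ ≤ m (matsubaraInt M ω) t)
    (hcont : ∀ (t : ι) (n : ℤ) (σ : Fin 2), Continuous fun p : Fin 2 → ℝ => vInf t n p σ)
    (hbdd : ∀ (t : ι) (n : ℤ) (p : Fin 2 → ℝ) (σ : Fin 2), ‖vInf t n p σ‖ ≤ m n t)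
    (hlim : ∀ (t : ι) (n : ℤ) (σ : Fin 2) (ε : ℝ), 0 < ε → ∃ L₁ : ℕ, ∀ (L : ℕ) [NeZero L], L₁ ≤ L →
      ∃ M₁ : ℕ, ∀ (M : ℕ) [NeZero M], M₁ ≤ M → ∀ ω : MatsubaraIdx M, matsubaraInt M ω = n →
        ∀ k : TorusSite 2 L, ‖v t L M (ω, k) σ - vInf t n (latticeMomentum L k) σ‖ ≤ ε) :
    FinalTwoLegVolLimit β U μ K Mstar :=
  volLimit_of_termwise_freq (S := fun L M _ _ k σ => klSelfEnergy L M β U μ K klE0 (nScales β + 1) k σ)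
    hm hB hrepr hmaj hcont hbdd hlim

end Summit.HubbardSuperconductivity.HubbardSuperconductivity.Theorems.KLRegimeSplit

end
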